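import Literature.NumberTheory.GaloisCohomology.Howard2004.SelfOrthogonalBaseChangeProofs
import Literature.NumberTheory.GaloisCohomology.Howard2004.ResidualLevelControlProofs
import Literature.NumberTheory.GaloisCohomology.Howard2004.ResidualDualityDatumProofs
import HarnessLib

/-!
# Howard 2004, H.4 for the RESIDUAL triple `(T̄, F̄)` on a `DVRSetting`: the propagated structure
# `F̄_k = (π̄_k)_* F` is its own exact orthogonal complement for the residual pairing (proofs file, RES-H4)

Topic `NumberTheory/GaloisCohomology/Howard2004` (sequel to `SelfOrthogonalBaseChangeProofs` — Remark 1.3.1 for H.4,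
generic over a presentation and a compatible pair of duality data —, `ResidualLevelControlProofs` — the residual
inclusion `ι : T̄ → T^{(k)}`, `ι ∘ π̄_k = π^{e_k-1}`, and the cartesian identities `F̄_k,w = H¹(ι)⁻¹ F_w` — and
`ResidualDualityDatumProofs` — the residual datum `D̄` with `D̄.e (π̄ s) (π̄ t) = π^{e_k-1} e(s,t)`).
THEOREMS ONLY: no definition, no named fact, no instance, no notation, no `sorry`.

B. Howard, *The Heegner point Kolyvagin system*, Compositio Math. **140** (2004) = arXiv:1202.6340: H.4 (p. 7 L69–82);
Remark 1.3.1 «hypotheses H.0–H.5 are stable under base change in the obvious sense» (p. 7 L125–127); Lemma 1.3.3 /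
Lemma 1.5.3 use the local and global dualities ON `T̄` with the structure `F` propagated to `T̄` (p. 7 L152–160,
p. 10 L10–19).  On a `DVRSetting S` with `hy : S.SatisfiesH`, at level `k`, for ANY residual datum `D̄` on `T̄ = S.ρbar`
over `R_k` with `D̄.e (π̄_k s) (π̄_k t) = π^{e_k-1} · e_k(s, t)` (those of `exists_residualDualityDatum`):

* **`DVRSetting.isSelfOrthogonal_residualStructure`** — `D̄.IsSelfOrthogonal F̄_k`,
  `F̄_k := (hy.h1 k).1.propagateStructure (S.t k).cond`: H.4 for `T̄` at EVERY finite place, from `hy.h4 k` by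
  `DualityDatum.isSelfOrthogonalAt_propagateStructure` with `ψ = (π^{e_k-1} ·)`, `f = ι`, `μ = id` and the cartesian
  identities `comap_residualInclusionLoc_cond_eq`.
* `DVRSetting.isSelfOrthogonalAt_residualStructure_modify_of_not_mem` — the same for the modified structures
  `F̄_k.modify 𝒯̄ a b n` at the places `v ∉ a ∪ b ∪ n`, `σ v ∉ a ∪ b ∪ n` (where they agree with `F̄_k`).

Cell `pub/bsd-print-x9`, G87 = Howard Thm. 1.6.1 (print leaf `stub_h161` of stmt-BirchSwinnertonDyer-22642); seat
`bsd-line-x10b-p1-w8` g11, brick (GD-LINE-S) part R2 (RES-H4).  HONEST FRAMING: `thm161_dvrKolyvaginBound` is NOT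
proved; no summit statement is proved; the Birch–Swinnerton-Dyer conjecture is not proved by any of this.

References: [Howard2004HeegnerKolyvagin] §1.3 H.4, Remark 1.3.1, Lemma 1.3.3, Lemma 1.5.3.
-/

set_option autoImplicit false

noncomputable section

open Function NumberField IsDedekindDomain Field
open scoped NumberField ContRepresentation

namespace Literature.NumberTheory.GaloisCohomology.Howard2004

open Literature.NumberTheory.GaloisRepresentations
open Literature.NumberTheory.GaloisRepresentations.DiscreteGaloisModule

namespace DVRSetting

variable {p : ℕ} [Fact p.Prime] {K : Type} [Field K] [NumberField K]
  {R : Type} [CommRing R] [IsDomain R] [IsDiscreteValuationRing R] [Algebra ℤ_[p] R]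
  {N : ℕ → Type} [∀ k, AddCommGroup (N k)] [∀ k, TopologicalSpace (N k)]
  [∀ k, DiscreteTopology (N k)] [∀ k, Module R (N k)]
  {Rk : ℕ → Type} [∀ k, CommRing (Rk k)] [∀ k, IsLocalRing (Rk k)] [∀ k, TopologicalSpace (Rk k)]
  [∀ k, DiscreteTopology (Rk k)] [∀ k, Algebra ℤ_[p] (Rk k)] [∀ k, Algebra R (Rk k)]
  [∀ k, Module (Rk k) (N k)] [∀ k, IsScalarTower R (Rk k) (N k)]
  {Nbar : Type} [AddCommGroup Nbar] [TopologicalSpace Nbar] [DiscreteTopology Nbar]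
  [∀ k, Module (Rk k) Nbar]
  {Nq : ℕ → Finset (HeightOneSpectrum (𝓞 K)) → Type} [∀ k n, AddCommGroup (Nq k n)]
  [∀ k n, TopologicalSpace (Nq k n)] [∀ k n, DiscreteTopology (Nq k n)]
  [∀ k n, Module (Rk k) (Nq k n)] [∀ k n, Module R (Nq k n)]
  [∀ k n, IsScalarTower R (Rk k) (Nq k n)]

/-- **H.4 for the residual triple: `F̄_k` is its own exact orthogonal complement for the residual pairing at every finite
place** (`F̄_k = (π̄_k)_* F`, `D̄` any residual datum with `D̄.e (π̄ s) (π̄ t) = π^{e_k-1} e_k(s,t)`).  Remark 1.3.1 for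
H.4 along `π̄_k : T^{(k)} ↠ T̄`: forward compatibility through `ψ = (π^{e_k-1}·)`, backward along the residual inclusion
`ι` (`ι ∘ π̄_k = π^{e_k-1}`, so `e_k(s, ι t̄) = D̄.e(π̄_k s, t̄)`, `μ = id`), the conditions `F̄_k` being `ι`-cartesian
(`comap_residualInclusionLoc_cond_eq`), and `hy.h4 k`.
[cite: Howard2004HeegnerKolyvagin, §1.3 H.4 and Remark 1.3.1 (arXiv:1202.6340 p. 7 L69–82, L125–127), Lemma 1.3.3 (p. 7 L152–160)] -/
theorem isSelfOrthogonal_residualStructure (S : DVRSetting p K R N Rk Nbar Nq) (hy : S.SatisfiesH) (k : ℕ)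
    (Dbar : DualityDatum p S.cd S.ρbar (Rk k))
    (hDbar : ∀ s t : N k, Dbar.e (S.πbar k s) (S.πbar k t) =
      algebraMap R (Rk k) S.π ^ (S.e k - 1) * (S.D k).e s t) :
    Dbar.IsSelfOrthogonal ((hy.h1 k).1.propagateStructure (S.t k).cond) := by
  intro v
  obtain ⟨ι, hι⟩ := S.exists_residualInclusion hy k
  have hequiv : ∀ (σ : absoluteGaloisGroup K) (x : Nbar), ι (S.ρbar σ x) = S.T.ρ k σ (ι x) :=
    S.residualInclusion_equivariant hy k ι hι
  refine DualityDatum.isSelfOrthogonalAt_propagateStructure (hy.h1 k).1 (S.D k) Dbar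
    (AddMonoidHom.mulLeft (algebraMap R (Rk k) S.π ^ (S.e k - 1))) (fun c a => ?_) (fun s t => ?_)
    ι.toAddMonoidHom hequiv (AddMonoidHom.id _) (fun _ _ => rfl) (fun s t => ?_)
    ((S.t k).cond) v ?_ ?_ (hy.h4 k v)
  · change algebraMap R (Rk k) S.π ^ (S.e k - 1) * (algebraMap ℤ_[p] (Rk k) c * a) =
      algebraMap ℤ_[p] (Rk k) c * (algebraMap R (Rk k) S.π ^ (S.e k - 1) * a)
    rw [mul_left_comm]
  · exact hDbar s t
  · obtain ⟨t, rfl⟩ := (hy.h1 k).1.surjective t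
    rw [AddMonoidHom.id_apply, hDbar, LinearMap.toAddMonoidHom_coe, hι,
      ← algebraMap_smul (Rk k) (S.π ^ (S.e k - 1)) t, map_smul, smul_eq_mul, map_pow]
  · exact (S.comap_residualInclusionLoc_cond_eq hy k ι hι hequiv (Sum.inr v)).symm
  · exact (S.comap_residualInclusionLoc_cond_eq hy k ι hι hequiv (Sum.inr (S.cd.σ • v))).symm

/-- **H.4 for the modified residual structures off the modified places**: for `F̄_k^{a}_{b}(n) = F̄_k.modify 𝒯̄ a b n`
and a finite place `v` with `v, σ v ∉ a ∪ b ∪ n`, the condition and its conjugate are those of `F̄_k`, so self-orthogonality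
at `v` is `isSelfOrthogonal_residualStructure`.
[cite: Howard2004HeegnerKolyvagin, §1.3 H.4 and Def. 1.2.2 (arXiv:1202.6340 p. 7 L69–82, p. 6 L101–125)] -/
theorem isSelfOrthogonalAt_residualStructure_modify_of_not_mem (S : DVRSetting p K R N Rk Nbar Nq)
    (hy : S.SatisfiesH) (k : ℕ) (Dbar : DualityDatum p S.cd S.ρbar (Rk k))
    (hDbar : ∀ s t : N k, Dbar.e (S.πbar k s) (S.πbar k t) =
      algebraMap R (Rk k) S.π ^ (S.e k - 1) * (S.D k).e s t)
    (a b n : Finset (HeightOneSpectrum (𝓞 K))) {v : HeightOneSpectrum (𝓞 K)}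
    (ha : v ∉ a) (hb : v ∉ b) (hn : v ∉ n) (ha' : S.cd.σ • v ∉ a) (hb' : S.cd.σ • v ∉ b) (hn' : S.cd.σ • v ∉ n) :
    Dbar.IsSelfOrthogonalAt
      (((hy.h1 k).1.propagateStructure (S.t k).cond).modify (transverseStructure p S.ρbar S.jbar) a b n) v := by
  have h := S.isSelfOrthogonal_residualStructure hy k Dbar hDbar v
  unfold DualityDatum.IsSelfOrthogonalAt at h ⊢
  rw [SelmerStructure.modify_inr_of_not_mem _ _ ha hb hn, SelmerStructure.modify_inr_of_not_mem _ _ ha' hb' hn']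
  exact h

end DVRSetting

end Literature.NumberTheory.GaloisCohomology.Howard2004

end
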